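import Literature.AlgebraicGeometry.AbelianSchemes.LevelStructureLocus
import Literature.AlgebraicGeometry.AbelianSchemes.PolarizedLevelTypeLiftableLocus
import Literature.AlgebraicGeometry.AbelianSchemes.AbelianSchemeIsLambdaOfAtConjugateTransport
import Literature.AlgebraicGeometry.Motives.OpenSubfunctorRepresentable
import Literature.AlgebraicGeometry.Motives.AbelianVarietySubvarietyOfFullDimension
import HarnessLib

/-!
# The locus tower of [MumfordFogartyKirwan1994] Prop. 7.3, steps (III) → (IV) → (V′): the `2g` sections are a
# symplectic-liftable level-`N` structure of type `δ` over a LOCALLY CLOSED subscheme of the base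

Topic `AlgebraicGeometry/AbelianSchemes`; namespace `Literature.AlgebraicGeometry.AbelianSchemes.AbelianSchemeOver`.
Cell hodgecm-mathlib (D-0151), F-DAG of the input (F) «Siegel fine moduli scheme», leaf F-6 «`H_{g,δ,N} ⊂ Hilb`
locally closed» (price sheet v1.4 §3 F-6; census `B-provers/B-p02/g14/CENSUS-F6-LocusTower.B-p02g14.md`; B-p02 (g14),
hand (a) of B-plan1 (g16) 08:23:17Z).  THEOREMS ONLY (no definition, no named fact, no instance, no `sorry`); books 0.
HC_CM is proved only modulo the 7 printed citations until rung 0 closes; this file discharges none of them.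

SETTING.  `A → S` an abelian scheme of relative dimension `g` over a locally Noetherian base `S` in whose residue fields
every positive integer is invertible, with a dual pair `D = (Â, 𝒫)`, a polarisation `λ : A → Â` (★ `Polarization`), a
polarisation type `δ`, a level `N ≠ 0`, and ANY `2g` sections `σ : Fin g ⊕ Fin g → A(S)`.  [MumfordFogartyKirwan1994,
Prop. 7.3] cuts `H_{g,d,n}` out of a Hilbert scheme by a TOWER of sub-loci `H₆ ⊂ ⋯ ⊂ H₁`; App. 7A / [Lan2013PELCompactifications,
Cor. 1.3.6.7] add the open and closed conditions «type `δ`» / «symplectic-liftable level».  The tree holds the storeys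
(III)+(IV) (★ `exists_isImmersion_iff_exists_levelStructure`: an IMMERSION `j₄ : H₄ → S`) and (V′) (★
`isClopen_setOf_typeAt_and_liftAt` + `hasType_and_isSymplecticLiftable_baseChange_iff_range_subset`: an OPEN AND CLOSED
subscheme of a base CARRYING a level structure); this file COMPOSES them into one immersion (step (V), the
`L^Δ(λ)³`-clause ★ `LDeltaCubeLocus`, does not involve the sections and is inserted by the tower assembler):
* §1 (T1) **`existsUnique_fac_comp_iff`** — composition of represented sub-functors along a monomorphism.
* §2 (T2) **`LevelStructure.forall_nonempty_symplecticLift_of_fibreIso`** — the POINTWISE form of ★ (T2)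
  `IsSymplecticLiftable.of_fibreIso`; **`…_of_comp_eq` / `…_iff_of_comp_eq`**, **`Polarization.exists_mulHom_iff_of_comp_eq`**
  — for `j : S′ → S`, `b : T → S` and geometric points `s′ ≫ j = t ≫ b`, the liftability / type clauses of the data pulled
  back to `S′` at `s′` and to `T` at `t` agree (both live on `A_{t ≫ b}`: ★ `fibreBaseChangeIso` twice and ★ `fibreCongrIso`,
  sections by ★ `map_fibreBaseChangeIso_restrictPt_sectionBaseChange`, witnesses by ★ `IsLambdaOfAt.of_baseChange` /
  `along_fibreCongrIso` / `baseChange`) — the transport letting the (V′) storey over `H₄` speak about any `b : T → S`.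
* §3 (V′) in `∃!`-form: **`exists_opens_isClopen_existsUnique_iff_hasType_and_isSymplecticLiftable`**.
* §4 HEAD **`exists_isImmersion_iff_existsUnique_symplecticLevel`** — an immersion `j : H → S` through which `b : T → S`
  factors, and then uniquely, iff `σ ×_S T` is a level-`N` structure `φ` on `A ×_S T` with `λ ×_S T` of type `δ` and `φ`
  symplectic-liftable of type `δ` (an object of `𝒜_{g,δ,N}(T)`, ★ `PolarizedAbelianSchemeWithLevel`, up to the dual pair).

## References
* [MumfordFogartyKirwan1994] D. Mumford, J. Fogarty, F. Kirwan, *Geometric Invariant Theory*, 3rd ed. (1994), Ch. 7 §2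
  Definition 7.2 (p. 129), Proposition 7.3 and its proof, steps (III)–(IV) (pp. 133–134); App. 7A (pp. 234–235).
* [Lan2013PELCompactifications] K.-W. Lan, *Arithmetic compactifications of PEL-type Shimura varieties* (2013), §1.3.6
  Lemma 1.3.6.6 and Cor. 1.3.6.7 (pp. 81–82).
* [MumfordAV1970] D. Mumford, *Abelian Varieties* (1970), §20 (property (3) of e_n, p. 186).
* [GortzWedhorn2020] U. Görtz, T. Wedhorn, *Algebraic Geometry I*, 2nd ed. (2020), Section (4.7) (pp. 107–108).
* Tree: ★ `LevelStructureLocus`, ★ `PolarizedLevelTypeLiftableLocus` / `LevelStructureSymplecticClassLocus[Clopen]`, ★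
  `AbelianSchemeSymplecticLevelTransfer`, ★ `AbelianSchemeIsLambdaOfAt{BaseChange,ConjugateTransport}`, ★ `OpenSubfunctorRepresentable`.
-/

noncomputable section

universe u

open CategoryTheory CategoryTheory.Limits AlgebraicGeometry

namespace Literature.AlgebraicGeometry.AbelianSchemes

namespace AbelianSchemeOver

open Literature.AlgebraicGeometry.Motives Literature.AlgebraicGeometry.ModuliOfAbelianVarieties
open scoped MonObj

/-! ### §0 Plumbing -/

section Plumbing

/-- An immersion is a monomorphism of schemes (closed immersion followed by an open immersion, Mathlib
`Scheme.Hom.liftCoborder_ι`). [folklore] -/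
private theorem mono_of_isImmersion {X Y : Scheme.{u}} (f : X ⟶ Y) [IsImmersion f] : Mono f := by
  rw [← f.liftCoborder_ι]
  exact mono_comp _ _

variable {S : Scheme.{u}} (A : AbelianSchemeOver S)

/-- The transport `fibreCongrIso h : A_{s₁} ≅ A_{s₂}` along an equality of base points carries the value of a section at
`s₁` to its value at `s₂`. [folklore] -/
private theorem map_fibreCongrIso_hom_restrictPt {K : Type u} [Field K] {s₁ s₂ : Spec (.of K) ⟶ S} (h : s₁ = s₂)
    (τ : A.Sections) :
    AlgPoints.map (A.fibreCongrIso h).hom.hom.hom.hom (A.restrictPt s₁ τ) = A.restrictPt s₂ τ := by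
  subst h
  exact Category.comp_id _

end Plumbing

/-! ### §1 (T1) Composition of represented sub-functors along a monomorphism -/

/-- **(T1) The tower step**: if `j₁ : H₁ → S` is a monomorphism, then `b : T → S` factors uniquely through the composite
`j₂ ≫ j₁ : H₂ → S` iff it factors through `j₁` by some `v` which in turn factors uniquely through `j₂` — how
[MumfordFogartyKirwan1994] Prop. 7.3 stacks the sub-loci `H_{i} ⊂ H_{i−1}`, each universal over the previous one. [cite: MumfordFogartyKirwan1994, Ch. 7 §2 Proposition 7.3, proof, steps (III)–(IV) (pp. 133–134)] -/
theorem existsUnique_fac_comp_iff {C : Type*} [Category C] {T H₁ H₂ S : C} (j₁ : H₁ ⟶ S) [Mono j₁] (j₂ : H₂ ⟶ H₁)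
    (b : T ⟶ S) :
    (∃! w : T ⟶ H₂, w ≫ j₂ ≫ j₁ = b) ↔ ∃ v : T ⟶ H₁, v ≫ j₁ = b ∧ ∃! w : T ⟶ H₂, w ≫ j₂ = v := by
  constructor
  · rintro ⟨w, hw, huniq⟩
    refine ⟨w ≫ j₂, by rw [Category.assoc, hw], w, rfl, fun w' hw' => huniq w' ?_⟩
    change w' ≫ j₂ = w ≫ j₂ at hw'
    rw [← Category.assoc, hw', Category.assoc, hw]
  · rintro ⟨v, hv, w, hw, huniq⟩
    refine ⟨w, ?_, fun w' hw' => huniq w' ((cancel_mono j₁).1 ?_)⟩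
    · change w ≫ j₂ ≫ j₁ = b
      rw [← Category.assoc, hw, hv]
    · change w' ≫ j₂ ≫ j₁ = b at hw'
      rw [Category.assoc, hw', hv]

/-! ### §2 (T2) The liftability clause at a geometric point moves along fibre identifications -/

section Engine

variable {S S' : Scheme.{u}} {A : AbelianSchemeOver S} {A' : AbelianSchemeOver S'} {D : A.DualPair}
  {pol : A.Polarization D} {D' : A'.DualPair} {pol' : A'.Polarization D'} {g₀ N : ℕ}
  {φ : A.LevelStructure g₀ N} {φ' : A'.LevelStructure g₀ N} {δ : Fin g₀ → ℕ} {Ω : Type u} [Field Ω]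
  {s : Spec (.of Ω) ⟶ S} {s' : Spec (.of Ω) ⟶ S'}

/-- **(T2, pointwise) The liftability clause moves along an isomorphism of fibre abelian varieties** compatible with the
level sections (`he`) and with the polarisations (`hpol`: ample witnesses of `λ̄′` at `s′` pull back along `e⁻¹` to ample
witnesses of `λ̄` at `s`): if every ample witness of `λ̄` at `s` admits a symplectic lift of `φ`, then every ample witness
of `λ̄′` at `s′` admits a symplectic lift of `φ′` — the body of ★ (T2) `IsSymplecticLiftable.of_fibreIso` at ONE point
(lift for `(e⁻¹)^*Θ′`, transport along `e` by ★ (T1) `SymplecticLift.nonempty_transport`, `e^*(e⁻¹)^*Θ′ ∼ Θ′` by ★ (T0)).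
[cite: Lan2013PELCompactifications, §1.3.6 Lemma 1.3.6.6 and Cor. 1.3.6.7 (pp. 81–82)]
[cite: MumfordAV1970, §20 (property (3) of e_n, p. 186)] -/
theorem LevelStructure.forall_nonempty_symplecticLift_of_fibreIso
    (e : (A'.fibre s').toAbelianVariety ≅ (A.fibre s).toAbelianVariety)
    (he : ∀ i : Fin g₀ ⊕ Fin g₀,
      AlgPoints.map e.hom.hom.hom.hom (A'.restrictPt s' (φ'.σ i)) = A.restrictPt s (φ.σ i))
    (hpol : ∀ Θ' : CartierDivisor (A'.fibre s').toAbelianVariety.X.left, Θ'.IsAmple →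
      A'.IsLambdaOfAt s' D' pol'.lam Θ' →
      haveI : IsDominant (AbelianVariety.Hom.toSchemeHom e.inv) :=
        AbelianVariety.isDominant_toSchemeHom_iso_hom e.symm
      (Θ'.pullback (AbelianVariety.Hom.toSchemeHom e.inv)).IsAmple ∧
        A.IsLambdaOfAt s D pol.lam (Θ'.pullback (AbelianVariety.Hom.toSchemeHom e.inv)))
    (h : ∀ Θ : CartierDivisor (A.fibre s).toAbelianVariety.X.left, Θ.IsAmple → A.IsLambdaOfAt s D pol.lam Θ →
      Nonempty (φ.SymplecticLift s Θ δ)) :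
    ∀ Θ' : CartierDivisor (A'.fibre s').toAbelianVariety.X.left, Θ'.IsAmple → A'.IsLambdaOfAt s' D' pol'.lam Θ' →
      Nonempty (φ'.SymplecticLift s' Θ' δ) := by
  intro Θ' hΘ' hlam'
  haveI h₁ := AbelianVariety.isDominant_toSchemeHom_iso_hom e
  haveI h₂ : IsDominant (AbelianVariety.Hom.toSchemeHom e.inv) :=
    AbelianVariety.isDominant_toSchemeHom_iso_hom e.symm
  obtain ⟨hΘ, hlam⟩ := hpol Θ' hΘ' hlam'
  obtain ⟨Λ⟩ := h _ hΘ hlam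
  obtain ⟨Λ'⟩ := Λ.nonempty_transport (φ' := φ') e he
  -- `e^*(e⁻¹)^*Θ′` is the same divisor as `Θ′`
  have hsame : ((Θ'.pullback (AbelianVariety.Hom.toSchemeHom e.inv)).pullback
      (AbelianVariety.Hom.toSchemeHom e.hom)).SameDivisor Θ' := by
    refine (Θ'.pullback_pullback_sameDivisor _ _).trans ?_
    have hcomp : AbelianVariety.Hom.toSchemeHom e.hom ≫ AbelianVariety.Hom.toSchemeHom e.inv = 𝟙 _ := by
      change AbelianVariety.Hom.toSchemeHom (e.hom ≫ e.inv) = _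
      rw [e.hom_inv_id]
      rfl
    exact (Θ'.pullback_congr_sameDivisor hcomp).trans Θ'.pullback_id_sameDivisor
  exact Λ'.nonempty_of_linEquiv hsame.linEquiv

end Engine

section Square

variable {S S' T : Scheme.{u}} (A : AbelianSchemeOver S) {D : A.DualPair} (pol : A.Polarization D) {g₀ N : ℕ}
  (σ : Fin g₀ ⊕ Fin g₀ → A.Sections) (δ : Fin g₀ → ℕ) (j : S' ⟶ S) (b : T ⟶ S)
  (φ' : LevelStructure g₀ N (A.baseChange j)) (φ : LevelStructure g₀ N (A.baseChange b))
  {Ω : Type u} [Field Ω] (s' : Spec (.of Ω) ⟶ S') (t : Spec (.of Ω) ⟶ T)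

/-- **`he` for two base changes with the same composite point.**  For `s′ ≫ j = t ≫ b`, the isomorphism
`(A ×_S T)_t ≅ A_{t ≫ b} = A_{s′ ≫ j} ≅ (A ×_S S′)_{s′}` (★ `fibreBaseChangeIso`, ★ `fibreCongrIso`) carries the value at `t`
of `σᵢ ×_S T` to the value at `s′` of `σᵢ ×_S S′` (★ `map_fibreBaseChangeIso_restrictPt_sectionBaseChange` on both sides).
[cite: MumfordFogartyKirwan1994, Ch. 7 §2 Definition 7.2 (p. 129)] [cite: GortzWedhorn2020, Section (4.7) (pp. 107–108)] -/
theorem map_fibreBaseChangeIso_trans_restrictPt_of_comp_eq (hpt : s' ≫ j = t ≫ b)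
    (hφ' : ∀ i, φ'.σ i = A.sectionBaseChange j (σ i)) (hφ : ∀ i, φ.σ i = A.sectionBaseChange b (σ i))
    (i : Fin g₀ ⊕ Fin g₀) :
    AlgPoints.map (A.fibreBaseChangeIso b t ≪≫ A.fibreCongrIso hpt.symm ≪≫
        (A.fibreBaseChangeIso j s').symm).hom.hom.hom.hom ((A.baseChange b).restrictPt t (φ.σ i)) =
      (A.baseChange j).restrictPt s' (φ'.σ i) := by
  rw [hφ, hφ']
  change AlgPoints.map ((A.fibreBaseChangeIso b t).hom.hom.hom.hom ≫ (A.fibreCongrIso hpt.symm).hom.hom.hom.hom ≫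
      (A.fibreBaseChangeIso j s').inv.hom.hom.hom) ((A.baseChange b).restrictPt t (A.sectionBaseChange b (σ i))) = _
  rw [AlgPoints.map_comp_apply, AlgPoints.map_comp_apply, A.map_fibreBaseChangeIso_restrictPt_sectionBaseChange b t (σ i),
    A.map_fibreCongrIso_hom_restrictPt hpt.symm (σ i)]
  exact map_inv_eq_of_map_hom_eq (A.fibreBaseChangeIso j s') (mk' := fun i => (A.baseChange j).restrictPt s'
    (A.sectionBaseChange j (σ i))) (mk := fun i => A.restrictPt (s' ≫ j) (σ i))
    (fun i => A.map_fibreBaseChangeIso_restrictPt_sectionBaseChange j s' (σ i)) i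

/-- **`hpol` for two base changes with the same composite point.**  For `s′ ≫ j = t ≫ b`, an ample witness `Θ` of
`(λ ×_S T)‾` at `t` pulls back along `(A ×_S S′)_{s′} ≅ A_{s′ ≫ j} = A_{t ≫ b} ≅ (A ×_S T)_t` to an ample witness of
`(λ ×_S S′)‾` at `s′`: down to `A` at `t ≫ b` (★ `IsLambdaOfAt.of_baseChange`), across the equality of points (★
`IsLambdaOfAt.along_fibreCongrIso`), up to `A ×_S S′` at `s′` (★ `IsLambdaOfAt.baseChange`); the three pull-backs
re-bracketed into one (★ `pullback_pullback_sameDivisor`, ★ `IsLambdaOfAt.of_sameDivisor`); ampleness along an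
isomorphism (★ `IsAmple.pullback`). [cite: MumfordFogartyKirwan1994, Ch. 6 §2 Definition 6.2–6.3 (p. 120)]
[cite: MumfordFogartyKirwan1994, Ch. 7 §2 Definition 7.2 (p. 129)] -/
theorem transfer_fibreBaseChangeIso_trans_of_comp_eq (hpt : s' ≫ j = t ≫ b)
    (Θ : CartierDivisor ((A.baseChange b).fibre t).toAbelianVariety.X.left) (hΘ : Θ.IsAmple)
    (hlam : (A.baseChange b).IsLambdaOfAt t (D.baseChange b) (pol.baseChange b).lam Θ) :
    haveI : IsDominant (AbelianVariety.Hom.toSchemeHom (A.fibreBaseChangeIso b t ≪≫ A.fibreCongrIso hpt.symm ≪≫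
        (A.fibreBaseChangeIso j s').symm).inv) :=
      AbelianVariety.isDominant_toSchemeHom_iso_hom (A.fibreBaseChangeIso b t ≪≫ A.fibreCongrIso hpt.symm ≪≫
        (A.fibreBaseChangeIso j s').symm).symm
    (Θ.pullback (AbelianVariety.Hom.toSchemeHom (A.fibreBaseChangeIso b t ≪≫ A.fibreCongrIso hpt.symm ≪≫
        (A.fibreBaseChangeIso j s').symm).inv)).IsAmple ∧
      (A.baseChange j).IsLambdaOfAt s' (D.baseChange j) (pol.baseChange j).lam
        (Θ.pullback (AbelianVariety.Hom.toSchemeHom (A.fibreBaseChangeIso b t ≪≫ A.fibreCongrIso hpt.symm ≪≫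
          (A.fibreBaseChangeIso j s').symm).inv)) := by
  haveI hd : IsDominant (AbelianVariety.Hom.toSchemeHom (A.fibreBaseChangeIso b t ≪≫ A.fibreCongrIso hpt.symm ≪≫
      (A.fibreBaseChangeIso j s').symm).inv) :=
    AbelianVariety.isDominant_toSchemeHom_iso_hom (A.fibreBaseChangeIso b t ≪≫ A.fibreCongrIso hpt.symm ≪≫
      (A.fibreBaseChangeIso j s').symm).symm
  haveI : IsIso (AbelianVariety.Hom.toSchemeHom (A.fibreBaseChangeIso b t ≪≫ A.fibreCongrIso hpt.symm ≪≫
      (A.fibreBaseChangeIso j s').symm).inv) := AbelianVariety.isIso_toSchemeHom_of_isIso _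
  refine ⟨hΘ.pullback _, ?_⟩
  haveI i₁ : IsDominant (AbelianVariety.Hom.toSchemeHom (A.fibreBaseChangeIso b t).inv) :=
    AbelianVariety.isDominant_toSchemeHom_iso_hom (A.fibreBaseChangeIso b t).symm
  haveI ic : IsDominant (AbelianVariety.Hom.toSchemeHom (A.fibreCongrIso hpt.symm).inv) :=
    AbelianVariety.isDominant_toSchemeHom_iso_hom (A.fibreCongrIso hpt.symm).symm
  haveI i₀ : IsDominant (AbelianVariety.Hom.toSchemeHom (A.fibreBaseChangeIso j s').hom) :=
    AbelianVariety.isDominant_toSchemeHom_iso_hom (A.fibreBaseChangeIso j s')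
  -- down to `A` at `t ≫ b`, across to `s′ ≫ j`, up to `A ×_S S′` at `s′`
  have h1 := IsLambdaOfAt.of_baseChange A b D t pol.lam Θ hlam
  have h2 := IsLambdaOfAt.along_fibreCongrIso A D pol.lam hpt.symm h1
  have h3 := IsLambdaOfAt.baseChange A j D s' pol.lam _ h2
  refine IsLambdaOfAt.of_sameDivisor (A.baseChange j) (D.baseChange j) (pol.baseChange j).lam s' ?_ h3
  haveI : IsDominant (AbelianVariety.Hom.toSchemeHom (A.fibreBaseChangeIso j s').hom ≫
      AbelianVariety.Hom.toSchemeHom (A.fibreCongrIso hpt.symm).inv) := inferInstance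
  haveI : IsDominant ((AbelianVariety.Hom.toSchemeHom (A.fibreBaseChangeIso j s').hom ≫
      AbelianVariety.Hom.toSchemeHom (A.fibreCongrIso hpt.symm).inv) ≫
        AbelianVariety.Hom.toSchemeHom (A.fibreBaseChangeIso b t).inv) := inferInstance
  exact ((CartierDivisor.pullback_pullback_sameDivisor
      (Θ.pullback (AbelianVariety.Hom.toSchemeHom (A.fibreBaseChangeIso b t).inv))
      (AbelianVariety.Hom.toSchemeHom (A.fibreCongrIso hpt.symm).inv)
      (AbelianVariety.Hom.toSchemeHom (A.fibreBaseChangeIso j s').hom)).trans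
    (CartierDivisor.pullback_pullback_sameDivisor Θ (AbelianVariety.Hom.toSchemeHom (A.fibreBaseChangeIso b t).inv)
      (AbelianVariety.Hom.toSchemeHom (A.fibreBaseChangeIso j s').hom ≫
        AbelianVariety.Hom.toSchemeHom (A.fibreCongrIso hpt.symm).inv))).trans
    (CartierDivisor.pullback_congr_sameDivisor Θ rfl)

/-- **(T2) THE LIFTABILITY CLAUSE FOR TWO BASE CHANGES WITH THE SAME COMPOSITE POINT.**  Let `φ′` on `A ×_S S′` and
`φ` on `A ×_S T` be level-`N` structures whose sections are the pulled-back `σᵢ` (`hφ′`, `hφ`), and let `s′`, `t` be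
geometric points of `S′`, `T` with `s′ ≫ j = t ≫ b`.  If every ample witness of `(λ ×_S S′)‾` at `s′` admits a symplectic
lift of `φ′`, then every ample witness of `(λ ×_S T)‾` at `t` admits a symplectic lift of `φ` — both clauses are
statements about the geometric fibre `A_{t ≫ b}` with its `2g` points `σᵢ(t ≫ b)` and its polarisation
([Lan2013PELCompactifications] Lemma 1.3.6.5), identified by §2's isomorphism. [cite: Lan2013PELCompactifications, §1.3.6 Lemma 1.3.6.6 and Cor. 1.3.6.7 (pp. 81–82)]
[cite: MumfordFogartyKirwan1994, Ch. 7 §2 Definition 7.2 (p. 129)] -/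
theorem LevelStructure.forall_nonempty_symplecticLift_of_comp_eq (hpt : s' ≫ j = t ≫ b)
    (hφ' : ∀ i, φ'.σ i = A.sectionBaseChange j (σ i)) (hφ : ∀ i, φ.σ i = A.sectionBaseChange b (σ i))
    (h' : ∀ Θ' : CartierDivisor ((A.baseChange j).fibre s').toAbelianVariety.X.left, Θ'.IsAmple →
      (A.baseChange j).IsLambdaOfAt s' (D.baseChange j) (pol.baseChange j).lam Θ' →
        Nonempty (φ'.SymplecticLift s' Θ' δ)) :
    ∀ Θ : CartierDivisor ((A.baseChange b).fibre t).toAbelianVariety.X.left, Θ.IsAmple →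
      (A.baseChange b).IsLambdaOfAt t (D.baseChange b) (pol.baseChange b).lam Θ → Nonempty (φ.SymplecticLift t Θ δ) :=
  LevelStructure.forall_nonempty_symplecticLift_of_fibreIso
    (A.fibreBaseChangeIso b t ≪≫ A.fibreCongrIso hpt.symm ≪≫ (A.fibreBaseChangeIso j s').symm)
    (A.map_fibreBaseChangeIso_trans_restrictPt_of_comp_eq σ j b φ' φ s' t hpt hφ' hφ)
    (A.transfer_fibreBaseChangeIso_trans_of_comp_eq pol j b s' t hpt) h'

/-- **The liftability clauses of `φ′` at `s′` and of `φ` at `t` are EQUIVALENT** when `s′ ≫ j = t ≫ b` (both directions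
of the previous statement, whose hypothesis is symmetric). [cite: Lan2013PELCompactifications, §1.3.6 Lemma 1.3.6.6 and Cor. 1.3.6.7 (pp. 81–82)]
[cite: MumfordFogartyKirwan1994, Ch. 7 §2 Definition 7.2 (p. 129)] -/
theorem LevelStructure.forall_nonempty_symplecticLift_iff_of_comp_eq (hpt : s' ≫ j = t ≫ b)
    (hφ' : ∀ i, φ'.σ i = A.sectionBaseChange j (σ i)) (hφ : ∀ i, φ.σ i = A.sectionBaseChange b (σ i)) :
    (∀ Θ' : CartierDivisor ((A.baseChange j).fibre s').toAbelianVariety.X.left, Θ'.IsAmple →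
      (A.baseChange j).IsLambdaOfAt s' (D.baseChange j) (pol.baseChange j).lam Θ' →
        Nonempty (φ'.SymplecticLift s' Θ' δ)) ↔
    ∀ Θ : CartierDivisor ((A.baseChange b).fibre t).toAbelianVariety.X.left, Θ.IsAmple →
      (A.baseChange b).IsLambdaOfAt t (D.baseChange b) (pol.baseChange b).lam Θ → Nonempty (φ.SymplecticLift t Θ δ) :=
  ⟨LevelStructure.forall_nonempty_symplecticLift_of_comp_eq A pol σ δ j b φ' φ s' t hpt hφ' hφ,
    LevelStructure.forall_nonempty_symplecticLift_of_comp_eq A pol σ δ b j φ φ' t s' hpt.symm hφ hφ'⟩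

/-- **The type clause for two base changes with the same composite point**: for `s′ ≫ j = t ≫ b`, the `δ`-clause of
`(λ ×_S S′)‾` at `s′` holds iff the `δ`-clause of `(λ ×_S T)‾` at `t` does (both are the clause of `λ̄` at `t ≫ b`, ★
`exists_mulHom_baseChange_iff`). [cite: MumfordFogartyKirwan1994, App. 7A (pp. 234–235)] -/
theorem Polarization.exists_mulHom_iff_of_comp_eq (hpt : s' ≫ j = t ≫ b) :
    (∃ ψ : Multiplicative (((i : Fin g₀) → ZMod (δ i)) × ((i : Fin g₀) → ZMod (δ i))) →*
        ((A.baseChange j).fibre s').toAbelianVariety.Points Ω,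
        Function.Injective ψ ∧ Set.range ψ = (pol.baseChange j).kerPointsAt s') ↔
      ∃ ψ : Multiplicative (((i : Fin g₀) → ZMod (δ i)) × ((i : Fin g₀) → ZMod (δ i))) →*
        ((A.baseChange b).fibre t).toAbelianVariety.Points Ω,
        Function.Injective ψ ∧ Set.range ψ = (pol.baseChange b).kerPointsAt t := by
  rw [pol.exists_mulHom_baseChange_iff j δ s', pol.exists_mulHom_baseChange_iff b δ t, hpt]

end Square

/-! ### §3 Step (V′) as a representability statement (`∃!`-form) over a base carrying the level structure -/

section VPrime

variable {S : Scheme.{u}} (A : AbelianSchemeOver S) {D : A.DualPair} (pol : A.Polarization D) {g₀ N : ℕ}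
  (φ : A.LevelStructure g₀ N) (δ : Fin g₀ → ℕ)

/-- **Step (V′), `∃!`-form: «type `δ` and symplectic-liftable level» is represented by an OPEN AND CLOSED subscheme.**
For `(A, λ, φ)` over a locally Noetherian `S` with every positive integer invertible in its residue fields, `A` of relative
dimension `g`, `δ` a polarisation type and `N ≠ 0`, there is an open `W ⊆ S`, also closed, such that `f : T → S` factors
through `W ↪ S` — and then uniquely — iff `λ ×_S T` has type `δ` and `φ ×_S T` is symplectic-liftable of type `δ`
(★ `isClopen_setOf_typeAt_and_liftAt`, ★ `hasType_and_isSymplecticLiftable_baseChange_iff_range_subset`, ★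
`existsUnique_comp_opensι_eq_iff_range_subset`). [cite: MumfordFogartyKirwan1994, Ch. 7 §2 Proposition 7.3 (pp. 133–134) and App. 7A (pp. 234–235)]
[cite: Lan2013PELCompactifications, §1.3.6 Lemma 1.3.6.6 and Cor. 1.3.6.7 (pp. 81–82)] -/
theorem exists_opens_isClopen_existsUnique_iff_hasType_and_isSymplecticLiftable [IsLocallyNoetherian S]
    (hg : A.IsOfRelDim g₀) (hQ : ∀ M : ℕ, M ≠ 0 → ∀ s : S, (M : S.residueField s) ≠ 0) (hδ : IsPolarizationType δ)
    (hN : N ≠ 0) :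
    ∃ W : S.Opens, IsClopen (W : Set S) ∧
      ∀ ⦃T : Scheme.{u}⦄ (f : T ⟶ S),
        (∃! v : T ⟶ (W : Scheme.{u}), v ≫ W.ι = f) ↔
          (pol.baseChange f).HasType δ ∧ (φ.baseChange f).IsSymplecticLiftable (pol.baseChange f) δ := by
  refine ⟨⟨_, (isClopen_setOf_typeAt_and_liftAt A pol φ δ hg hQ hδ hN).isOpen⟩,
    isClopen_setOf_typeAt_and_liftAt A pol φ δ hg hQ hδ hN, fun T f => ?_⟩
  rw [existsUnique_comp_opensι_eq_iff_range_subset]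
  exact (hasType_and_isSymplecticLiftable_baseChange_iff_range_subset A pol φ δ hg hQ hδ hN f).symm

end VPrime

/-! ### §4 HEAD — the segment (III) → (IV) → (V′) of the tower as ONE immersion -/

section Head

variable {S : Scheme.{u}} (A : AbelianSchemeOver S) {D : A.DualPair} (pol : A.Polarization D) {g₀ N : ℕ}
  (δ : Fin g₀ → ℕ)

/-- **THE LOCUS «the `2g` sections are a symplectic-liftable level-`N` structure of type `δ`» IS REPRESENTED BY A LOCALLY
CLOSED SUBSCHEME** ([MumfordFogartyKirwan1994] Prop. 7.3, steps (III) «`H₃ ⊂ H₂` closed: points of order `n`», (IV)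
«`H₄ ⊂ H₃` open: a basis on every geometric fibre», and App. 7A / [Lan2013PELCompactifications] Cor. 1.3.6.7 «type `δ`
and symplectic-liftable: open and closed», composed): for an abelian scheme `A → S` of relative dimension `g` over a
locally Noetherian `S` with every positive integer invertible in its residue fields, a polarisation `λ`, a polarisation
type `δ`, `N ≠ 0` and ANY `2g` sections `σᵢ ∈ A(S)`, there is an immersion `j : H → S` such that `b : T → S` factors
through `j` — and then uniquely — iff the pulled-back sections `σᵢ ×_S T` are the sections of a level-`N` structure `φ`
on `A ×_S T`, `λ ×_S T` has type `δ`, and `φ` is symplectic-liftable of type `δ` for `λ ×_S T`.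
Construction: `H = W ↪ H₄ ↪ S`, `j₄ : H₄ → S` the immersion of ★ (III)+(IV) and `W ⊆ H₄` the open and closed locus
of ★ (V′) for the tautological level structure `σ ×_S H₄`; universal property by (T1), ★
`existsUnique_comp_opensι_eq_iff_range_subset`, the one-point criteria ★ `Polarization.typeAt_of_exists_mulHom` / ★
`LevelStructure.liftAt_of_nonempty_symplecticLift`, and the transport (T2) of §2 at geometric points.
[cite: MumfordFogartyKirwan1994, Ch. 7 §2 Proposition 7.3, proof, steps (III)–(IV) (pp. 133–134)]
[cite: MumfordFogartyKirwan1994, Ch. 7 §2 Proposition 7.3 (pp. 133–134) and App. 7A (pp. 234–235)]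
[cite: Lan2013PELCompactifications, §1.3.6 Lemma 1.3.6.6 and Cor. 1.3.6.7 (pp. 81–82)] -/
theorem exists_isImmersion_iff_existsUnique_symplecticLevel [IsLocallyNoetherian S] (hg : A.IsOfRelDim g₀)
    (hQ : ∀ M : ℕ, M ≠ 0 → ∀ s : S, (M : S.residueField s) ≠ 0) (hδ : IsPolarizationType δ) (hN : N ≠ 0)
    (σ : Fin g₀ ⊕ Fin g₀ → A.Sections) :
    ∃ (H : Scheme.{u}) (j : H ⟶ S), IsImmersion j ∧
      ∀ ⦃T : Scheme.{u}⦄ (b : T ⟶ S),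
        (∃! v : T ⟶ H, v ≫ j = b) ↔
          ∃ φ : LevelStructure g₀ N (A.baseChange b), (∀ i, φ.σ i = A.sectionBaseChange b (σ i)) ∧
            (pol.baseChange b).HasType δ ∧ φ.IsSymplecticLiftable (pol.baseChange b) δ := by
  haveI : NeZero N := ⟨hN⟩
  obtain ⟨H₄, j, hj, H4⟩ := A.exists_isImmersion_iff_exists_levelStructure hg (hQ N hN) σ
  haveI := hj
  haveI : Mono j := mono_of_isImmersion j
  haveI : IsLocallyNoetherian H₄ := LocallyOfFiniteType.isLocallyNoetherian j
  -- the tautological level structure `σ ×_S H₄` over `H₄` (steps (III)+(IV) at `f = j₄`)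
  obtain ⟨φ', hφ'⟩ := (H4 j).2
    ⟨𝟙 H₄, Category.id_comp j, fun h hh => (cancel_mono j).1 (hh.trans (Category.id_comp j).symm)⟩
  have hQ' : ∀ M : ℕ, M ≠ 0 → ∀ x : H₄, (M : H₄.residueField x) ≠ 0 := fun M hM x =>
    natCast_residueField_ne_zero_of_hom j (hQ M hM) x
  -- step (V′) over `H₄`: the open and closed locus `W ⊆ H₄` of the tautological level structure
  let W : H₄.Opens := ⟨_, (isClopen_setOf_typeAt_and_liftAt (A.baseChange j) (pol.baseChange j) φ' δ
    (hg.baseChange j) hQ' hδ hN).isOpen⟩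
  refine ⟨(W : Scheme.{u}), W.ι ≫ j, inferInstance, fun T b => ?_⟩
  rw [existsUnique_fac_comp_iff j W.ι b]
  constructor
  · rintro ⟨h, hb, hw⟩
    have hW : Set.range h ⊆ (W : Set H₄) := (existsUnique_comp_opensι_eq_iff_range_subset W h).1 hw
    obtain ⟨φ, hφ⟩ := (H4 b).2 ⟨h, hb, fun h' hh' => (cancel_mono j).1 (hh'.trans hb.symm)⟩
    refine ⟨φ, hφ, ?_, ?_⟩
    · -- type `δ`: the clause at every geometric point `t` of `T` is the clause at the point `t ≫ h` of `W`
      rw [pol.hasType_baseChange_iff_forall A δ b]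
      refine ⟨hδ, fun Ω _ _ t => ?_⟩
      obtain ⟨hx, -⟩ := hW ⟨t (IsLocalRing.closedPoint Ω), rfl⟩
      have hpt : (t ≫ h) ≫ j = t ≫ b := by rw [Category.assoc, hb]
      exact (pol.exists_mulHom_baseChange_iff b δ t).1
        ((Polarization.exists_mulHom_iff_of_comp_eq A pol δ j b (t ≫ h) t hpt).1
          (hx Ω (t ≫ h) (Scheme.Hom.comp_apply _ _ _)))
    · -- symplectic-liftable: the clause at `t` is the clause of `σ ×_S H₄` at `t ≫ h` (T2)
      intro Ω _ _ t Θ hΘ hlam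
      obtain ⟨-, hx⟩ := hW ⟨t (IsLocalRing.closedPoint Ω), rfl⟩
      have hpt : (t ≫ h) ≫ j = t ≫ b := by rw [Category.assoc, hb]
      exact LevelStructure.forall_nonempty_symplecticLift_of_comp_eq A pol σ δ j b φ' φ (t ≫ h) t hpt hφ' hφ
        (hx Ω (t ≫ h) (Scheme.Hom.comp_apply _ _ _)) Θ hΘ hlam
  · rintro ⟨φ, hφ, hT, hL⟩
    obtain ⟨h, hb, -⟩ := (H4 b).1 ⟨φ, hφ⟩
    refine ⟨h, hb, (existsUnique_comp_opensι_eq_iff_range_subset W h).2 ?_⟩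
    rintro _ ⟨y, rfl⟩
    -- a geometric point `t₀` of `T` at `y`; one point over `h y` decides `Type(h y)` and `Lift(h y)`
    let Ω₀ : Type u := AlgebraicClosure (T.residueField y)
    let t₀ : Spec (.of Ω₀) ⟶ T :=
      Spec.map (CommRingCat.ofHom (algebraMap (T.residueField y) Ω₀)) ≫ T.fromSpecResidueField y
    have ht₀ : t₀.base (IsLocalRing.closedPoint Ω₀) = y := by
      change (T.fromSpecResidueField y).base _ = y
      exact Scheme.fromSpecResidueField_apply y _
    have hs₀ : (t₀ ≫ h).base (IsLocalRing.closedPoint Ω₀) = h.base y := by rw [Scheme.Hom.comp_apply, ht₀]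
    have hpt : (t₀ ≫ h) ≫ j = t₀ ≫ b := by rw [Category.assoc, hb]
    refine ⟨?_, ?_⟩
    · exact (pol.baseChange j).typeAt_of_exists_mulHom (A.baseChange j) δ (fun s m hm => hQ' m hm.ne' s) hδ (t₀ ≫ h)
        hs₀ ((Polarization.exists_mulHom_iff_of_comp_eq A pol δ j b (t₀ ≫ h) t₀ hpt).2
          ((pol.exists_mulHom_baseChange_iff b δ t₀).2 (((pol.hasType_baseChange_iff_forall A δ b).1 hT).2 Ω₀ t₀)))
    · obtain ⟨Θ₀, hΘ₀, hlam₀⟩ := (pol.baseChange j).exists_ample Ω₀ (t₀ ≫ h)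
      obtain ⟨Λ₀⟩ := LevelStructure.forall_nonempty_symplecticLift_of_comp_eq A pol σ δ b j φ φ' t₀ (t₀ ≫ h) hpt.symm
        hφ hφ' (hL Ω₀ t₀) Θ₀ hΘ₀ hlam₀
      exact LevelStructure.liftAt_of_nonempty_symplecticLift (A.baseChange j) (pol.baseChange j) φ' δ (hg.baseChange j)
        hQ' hN (t₀ ≫ h) hs₀ hlam₀ Λ₀

end Head


end AbelianSchemeOver

end Literature.AlgebraicGeometry.AbelianSchemes

end
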